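import Mathlib
import Summits.HodgeConjecture.HodgeConjecture.Theses.TropicalWeilObstruction

/-!
# Birth skeleton (BC3) for the crux `TropicalHodgeBound` of route `TropicalWeilObstruction`

Crux (route decl, fixed): for every positive definite `Q` commuting with `J = weilJ 4` whose 16 free
entries are algebraically independent over `ℚ`, three effective tropical 4-cycles on `ℝ⁸/Q·ℤ⁸` with
vanishing Weil functional have `ℚ`-linearly dependent cycle classes.

Line (card K3/K4 of the route; Mikhalkin–Zharkov Prop. 4.3 / Thm. 5.4, Zharkov §2):
* `Ŵ` (`weilPairing`): the linear functional `x ⊗ y ↦ dz(x)·dz(y)` on `⋀⁴ℝ⁸ ⊗ ⋀⁴ℝ⁸`, written in the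
  all-maps Plücker coordinates used by `TropicalTorusCycle.cyc`; `W = Ŵ ∘ cyc` (Cauchy–Binet) —
  `stub_weilFunctional_eq_pairing`;
* `Ŵ(θ₄(Q)) = det (M Q Mᵀ) = 0` for `QJ = JQ`, `M = [1 | i·1]` — `stub_weilPairing_thetaClass`;
* `Ŵ(w₁(Q)) = 2⁷ det(A - iB) ∈ ℝ_{>0}` and `Ŵ(w₂(Q)) = ∓ i·2⁷ det(A - iB)` for `Q = [[A, B], [-B, A]] ≻ 0`,
  so `Ŵ(w₁), Ŵ(w₂)` are `ℚ`-linearly independent — `stub_weilPairing_weilClasses`;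
* (the L content: rationality `[Z] ∈ ⋀⁴(Qℤ⁸) ⊗ ⋀⁴ℤ⁸ ⊗ ℚ`, Hodge-ness `[Z] ∈ ker φ_Q`, and the generic
  rank-3 certificate `(rational) ∩ ker φ_Q = ℚ⟨θ₄, w₁, w₂⟩` at Weil-generic `Q`) every effective
  tropical 4-cycle class has rational coordinates in `(θ₄(Q), w₁(Q), w₂(Q))` —
  `stub_rationalHodgeCoordinates`.
Composition: the sorry-free `TropicalHodgeBound_of_pieces : WeilFunctionalEqPairing → WeilPairingThetaClass →
WeilPairingWeilClasses → RationalHodgeCoordinates → <the crux statement, verbatim>` (`Ŵ(cyc c_j) = W(c_j) = 0`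
forces the `w₁, w₂` coordinates to vanish, so the three classes lie on the `ℚ`-line through `θ₄(Q)` and
are dependent), and the skeleton theorem `TropicalHodgeBound_of : TropicalHodgeBound` (the route decl BY
NAME) discharging its four hypotheses with the declared stubs — the gate shape admitted by
`ledger skeleton check` (hypotheses of the crux-headed theorem must be registered obligations; `sorry`
only inside `stub_*`). BC3 probes (`stub statement → TropicalHodgeBound`, `→ HodgeConjecture`,
`→ ¬HodgeConjecture` by `first | exact? | simpa | aesop`, definitions only in scope) all fail: see the
sibling probe files of the registering seat.
-/

noncomputable section

namespace Summit.HodgeConjecture.HodgeConjecture.Cruxes.TropicalHodgeBound.Birth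

open scoped BigOperators
open Literature.AlgebraicGeometry.Tropical

/-- `dz(S)`: the all-maps Plücker coordinate at `S : Fin n → Fin 2n` of `dz = dz₁ ∧ … ∧ dz_n`,
`z_k = x_k + i·x_{k+n}`, i.e. `det` of the columns `S(0), …, S(n-1)` of the `n × 2n` matrix
`M = [1 | i·1]` (so that `frameComplexDet n L = det (M L) = (1/n!) Σ_S dz(S) · det L[S,:]`). -/
def dzCoord (n : ℕ) (S : Fin n → Fin (2 * n)) : ℂ :=
  (Matrix.of fun k a : Fin n =>
    (if (S a : ℕ) = (k : ℕ) then (1 : ℂ) else 0) +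
      (if (S a : ℕ) = (k : ℕ) + n then Complex.I else 0)).det

/-- `Ŵ`: the `ℝ`-linear functional `x ⊗ y ↦ dz(x)·dz(y)` on `⋀ⁿℝ²ⁿ ⊗ ⋀ⁿℝ²ⁿ` in all-maps Plücker
coordinates `C : (Fin n → Fin 2n) → (Fin n → Fin 2n) → ℝ` (normalised by `(n!)²` for the `n!`-fold
over-counting of each increasing selection in each factor). -/
def weilPairing (n : ℕ) : ((Fin n → Fin (2 * n)) → (Fin n → Fin (2 * n)) → ℝ) →ₗ[ℝ] ℂ where
  toFun C := ∑ S, ∑ S', dzCoord n S * dzCoord n S' / ((n.factorial : ℂ) ^ 2) * (C S S' : ℂ)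
  map_add' C D := by
    simp only [Pi.add_apply, Complex.ofReal_add, mul_add, Finset.sum_add_distrib]
  map_smul' r C := by
    simp only [Pi.smul_apply, smul_eq_mul, Complex.ofReal_mul, RingHom.id_apply, Complex.real_smul,
      Finset.mul_sum]
    refine Finset.sum_congr rfl fun S _ => Finset.sum_congr rfl fun S' _ => ?_
    ring

/-- The theta class `θ_n(Q) = Σ_I Qe_I ⊗ e_I ∈ ⋀ⁿ(Qℤ²ⁿ) ⊗ ⋀ⁿℤ²ⁿ` in all-maps Plücker coordinates:
`(S, S') ↦ det Q[S, S']`. -/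
def thetaClass (n : ℕ) (Q : Matrix (Fin (2 * n)) (Fin (2 * n)) ℝ) :
    (Fin n → Fin (2 * n)) → (Fin n → Fin (2 * n)) → ℝ :=
  fun S S' => (Q.submatrix S S').det

/-- The `2n × n` complex frame `N = (ω₀ | … | ω_{n-1})`, `ω_b = e_b - i·e_{b+n}`, of
`Ω = ω₀ ∧ … ∧ ω_{n-1} ∈ ⋀ⁿ ℤ[i]²ⁿ` (Zharkov's `𝘄`). -/
def omegaFrame (n : ℕ) : Matrix (Fin (2 * n)) (Fin n) ℂ :=
  Matrix.of fun a b =>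
    (if (a : ℕ) = (b : ℕ) then (1 : ℂ) else 0) - (if (a : ℕ) = (b : ℕ) + n then Complex.I else 0)

/-- The complex tropical Weil class `w(Q) = (⋀ⁿQ ⊗ 1)(Ω ⊗ Ω)` in all-maps Plücker coordinates:
`(S, S') ↦ det ((Q N)[S,:]) · det (N[S',:])`. -/
def weilClassC (n : ℕ) (Q : Matrix (Fin (2 * n)) (Fin (2 * n)) ℝ) :
    (Fin n → Fin (2 * n)) → (Fin n → Fin (2 * n)) → ℂ :=
  fun S S' => ((Q.map ((↑) : ℝ → ℂ) * omegaFrame n).submatrix S id).det *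
    ((omegaFrame n).submatrix S' id).det

/-- `w₁(Q) = Re w(Q)`, a rational class (first factor in `⋀ⁿ(Qℤ²ⁿ)`, second in `⋀ⁿℤ²ⁿ`). -/
def weilClassRe (n : ℕ) (Q : Matrix (Fin (2 * n)) (Fin (2 * n)) ℝ) :
    (Fin n → Fin (2 * n)) → (Fin n → Fin (2 * n)) → ℝ :=
  fun S S' => (weilClassC n Q S S').re

/-- `w₂(Q) = Im w(Q)`. -/
def weilClassIm (n : ℕ) (Q : Matrix (Fin (2 * n)) (Fin (2 * n)) ℝ) :
    (Fin n → Fin (2 * n)) → (Fin n → Fin (2 * n)) → ℝ :=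
  fun S S' => (weilClassC n Q S S').im

/-! ### Stub statements (named `Prop`s) -/

/-- (M) `W = Ŵ ∘ cyc`: the Weil functional of an effective tropical 4-cycle is the value of the linear
functional `Ŵ` on its cycle class (Cauchy–Binet for `det (M L_σ)`, cell by cell). -/
def WeilFunctionalEqPairing : Prop :=
  ∀ (Q : Matrix (Fin (2 * 4)) (Fin (2 * 4)) ℝ) (Z : TropicalTorusCycle (2 * 4) 4 Q),
    weilFunctional Z = weilPairing 4 Z.cyc

/-- (S/M) `Ŵ` kills the theta class of a `J`-commuting period matrix:
`Ŵ(θ₄(Q)) = det (M Q Mᵀ)` (Cauchy–Binet twice) and `M Q Mᵀ = (A - A) + i(B - B) = 0` for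
`Q = [[A, B], [-B, A]]`. -/
def WeilPairingThetaClass : Prop :=
  ∀ Q : Matrix (Fin (2 * 4)) (Fin (2 * 4)) ℝ,
    Q * weilJ 4 = weilJ 4 * Q → weilPairing 4 (thetaClass 4 Q) = 0

/-- (M) `Ŵ(w₁(Q))` and `Ŵ(w₂(Q))` are `ℚ`-linearly independent complex numbers for `Q ≻ 0`, `QJ = JQ`:
`Ŵ(w₁) ± i Ŵ(w₂) ∈ {4⁴ det(A - iB), 0}` with `A - iB` hermitian positive definite, so one of them is a
non-zero real and the other a non-zero purely imaginary number. -/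
def WeilPairingWeilClasses : Prop :=
  ∀ Q : Matrix (Fin (2 * 4)) (Fin (2 * 4)) ℝ, Q.PosDef → Q * weilJ 4 = weilJ 4 * Q →
    ∀ s t : ℚ, (s : ℂ) * weilPairing 4 (weilClassRe 4 Q) + (t : ℂ) * weilPairing 4 (weilClassIm 4 Q) = 0 →
      s = 0 ∧ t = 0

/-- (L — the load-bearing statement) RATIONAL TROPICAL HODGE COORDINATES at a Weil-generic period:
every effective tropical 4-cycle class on `ℝ⁸/Q·ℤ⁸` is a rational combination of
`θ₄(Q), w₁(Q), w₂(Q)` (`[Z] ∈ ⋀⁴(Qℤ⁸) ⊗ ⋀⁴ℤ⁸ ⊗ ℚ` by the homology of the torus, `[Z] ∈ ker φ_Q` by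
Mikhalkin–Zharkov Thm. 5.4, and the generic-rank certificate `4900 - 4897 = 3`). -/
def RationalHodgeCoordinates : Prop :=
  ∀ Q : Matrix (Fin (2 * 4)) (Fin (2 * 4)) ℝ, Q.PosDef → Q * weilJ 4 = weilJ 4 * Q →
    IsWeilGeneric 4 Q → ∀ Z : TropicalTorusCycle (2 * 4) 4 Q, ∃ q : Fin 3 → ℚ,
      Z.cyc = ((q 0 : ℚ) : ℝ) • thetaClass 4 Q + ((q 1 : ℚ) : ℝ) • weilClassRe 4 Q +
        ((q 2 : ℚ) : ℝ) • weilClassIm 4 Q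

/-! ### Stubs (the ONLY `sorry`s of the file) -/

/-- Stub 1 (M): `W = Ŵ ∘ cyc`. [cite: MikhalkinZharkov2014Eigenwave, Prop. 4.3]
[cite: Zharkov2020TropicalWeil, §2] -/
theorem stub_weilFunctional_eq_pairing : WeilFunctionalEqPairing := by
  sorry

/-- Stub 2 (S/M): `Ŵ(θ₄(Q)) = 0` for `QJ = JQ`. [cite: Zharkov2020TropicalWeil, §2] -/
theorem stub_weilPairing_thetaClass : WeilPairingThetaClass := by
  sorry

/-- Stub 3 (M): `Ŵ(w₁(Q)), Ŵ(w₂(Q))` are `ℚ`-independent for `Q ≻ 0`, `QJ = JQ`.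
[cite: Zharkov2020TropicalWeil, §2] -/
theorem stub_weilPairing_weilClasses : WeilPairingWeilClasses := by
  sorry

/-- Stub 4 (L, hardest): rational tropical Hodge coordinates `(θ₄, w₁, w₂)` at Weil-generic `Q`.
[cite: MikhalkinZharkov2014Eigenwave, Prop. 4.3 and Thm. 5.4] [cite: Zharkov2020TropicalWeil, §2] -/
theorem stub_rationalHodgeCoordinates : RationalHodgeCoordinates := by
  sorry

/-! ### Composition (sorry-free) -/

/-- The implication content, sorry-free: the four pieces give the crux statement VERBATIM —
`Ŵ(cyc c_j) = W(c_j) = 0` forces the `w₁, w₂` coordinates of each class to vanish, so the three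
classes are rational multiples of `θ₄(Q)`, hence `ℚ`-dependent. -/
theorem TropicalHodgeBound_of_pieces (h₁ : WeilFunctionalEqPairing) (h₂ : WeilPairingThetaClass)
    (h₃ : WeilPairingWeilClasses) (h₄ : RationalHodgeCoordinates) :
    ∀ Q : Matrix (Fin (2 * 4)) (Fin (2 * 4)) ℝ, Q.PosDef → Q * weilJ 4 = weilJ 4 * Q →
      IsWeilGeneric 4 Q → ∀ c : Fin 3 → TropicalTorusCycle (2 * 4) 4 Q,
        (∀ j, weilFunctional (c j) = 0) → ¬ LinearIndependent ℚ fun j => (c j).cyc := by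
  intro Q hQ hJ hgen c hW
  -- rational coordinates of the three classes
  choose q hq using fun j => h₄ Q hQ hJ hgen (c j)
  -- the Weil coordinates vanish
  have hq12 : ∀ j, q j 1 = 0 ∧ q j 2 = 0 := by
    intro j
    refine h₃ Q hQ hJ (q j 1) (q j 2) ?_
    have h0 : weilPairing 4 (c j).cyc = 0 := by rw [← h₁]; exact hW j
    rw [hq j, map_add, map_add, map_smul, map_smul, map_smul, h₂ Q hJ, smul_zero, zero_add,
      Complex.real_smul, Complex.real_smul, Complex.ofReal_ratCast, Complex.ofReal_ratCast] at h0
    exact h0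
  -- so every class is a rational multiple of θ₄(Q)
  have hθ : ∀ j, (c j).cyc = ((q j 0 : ℚ) : ℝ) • thetaClass 4 Q := by
    intro j
    rw [hq j, (hq12 j).1, (hq12 j).2]
    simp
  -- three vectors on one rational line are dependent
  rw [Fintype.not_linearIndependent_iff]
  by_cases h00 : q 0 0 = 0
  · refine ⟨![1, 0, 0], ?_, ⟨0, by simp⟩⟩
    simp only [Fin.sum_univ_three]
    rw [hθ 0, h00]
    simp
  · refine ⟨![q 1 0, -(q 0 0), 0], ?_, ⟨1, by simpa using h00⟩⟩
    simp only [Fin.sum_univ_three]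
    rw [hθ 0, hθ 1]
    funext S S'
    simp only [Matrix.cons_val_zero, Matrix.cons_val_one, Matrix.cons_val_two, Matrix.head_cons,
      Matrix.tail_cons, Pi.add_apply, Pi.smul_apply, Pi.zero_apply, smul_eq_mul, zero_smul,
      add_zero, Rat.smul_def]
    push_cast
    ring

/-- **THE SKELETON THEOREM.** The crux
`Summit.HodgeConjecture.HodgeConjecture.Theses.TropicalWeilObstruction.TropicalHodgeBound`, concluded
BY NAME from the four DECLARED stubs (the only `sorry`s of the file) through the sorry-free
composition `TropicalHodgeBound_of_pieces`. [cite: Zharkov2020TropicalWeil, §2] -/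
theorem TropicalHodgeBound_of :
    Summit.HodgeConjecture.HodgeConjecture.Theses.TropicalWeilObstruction.TropicalHodgeBound :=
  TropicalHodgeBound_of_pieces stub_weilFunctional_eq_pairing stub_weilPairing_thetaClass
    stub_weilPairing_weilClasses stub_rationalHodgeCoordinates

end Summit.HodgeConjecture.HodgeConjecture.Cruxes.TropicalHodgeBound.Birth

end
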